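import Literature.Analysis.UnboundedOperators.LinearizedBoltzmannChapmanEnskogInverse
import Literature.MathematicalPhysics.KineticTheory.HydrodynamicLimitsMomentsProofs
import Literature.Analysis.UnboundedOperators.LinearizedBoltzmannBurnettProofs
import HarnessLib

/-!
# Bounded functions with bounded image under the linearised hard-sphere operator

Sibling proof file of `LinearizedBoltzmannGaussGrowth` / `LinearizedBoltzmannKernelActionContinuity`
(Grad's splitting `L = 2 K₂' - K₁ - ν` of the linearised hard-sphere operator around the normalised
Maxwellian `M`, `M dv = stdGaussian`, CIP 1994 §7.2). We record three elementary facts used to build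
explicit pre-images of bounded functions under `L`:

* `abs_lossAction_le_of_integral_eq_zero` — the loss piece `∫ (∫ ((v - w)·ω)₊ dω) ψ(w) dM(w)` of a
  **bounded mean-zero** `ψ` is bounded in `v` (the angular integral is `σ(S)|w|`-Lipschitz in `w`,
  `abs_sphereIntegral_hardSphereKernel_sub_le`), in any dimension;
* `kernelAction_sub_of_gaussGrowth`, `hardSphereLinearizedOp_sub_inner` — `L` is additive on
  measurable functions of Gaussian growth and `L (ψ - ⟪m, ·⟫) = L ψ` at every velocity (the linear
  functions are collision invariants), in any dimension;
* `exists_abs_hardSphereLinearizedOp_le_of_bounded_support` — in `ℝ³`, a bounded measurable `ψ` of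
  bounded support and mean zero has `sup_v |L ψ (v)| < ∞` (Carleman gain bounded by
  `p(0) ∫_{|v+u| ≤ R} |u|⁻¹ du`, `abs_carlemanGain_le_of_bounded_support`).

These are the inputs of `LinearizedBoltzmannOrthogonalInverseUnbounded` (an explicit bounded `g ⊥`
collision invariants whose `L²(M)`-orthogonal pre-image under `L` grows linearly). No new
definitions are introduced.
-/

open MeasureTheory Metric Real Set Filter Topology ProbabilityTheory Module
open scoped InnerProductSpace ENNReal

namespace Literature.Analysis.UnboundedOperators

noncomputable section

open Literature.MathematicalPhysics.KineticTheory (collide sphereMeasure hardSphereKernel carlemanKernel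
  gradRadial carlemanKernel_nonneg gradRadial_nonneg carlemanGain integrable_gradRadial
  collide_fst_add_collide_snd)
open Literature.Analysis.FluidPDE

section GeneralE

variable {E : Type*} [NormedAddCommGroup E] [InnerProductSpace ℝ E] [FiniteDimensional ℝ E]
  [MeasurableSpace E] [BorelSpace E]

/-! ### The loss piece of a bounded mean-zero function is bounded -/

/-- The angular integral is Lipschitz in the field velocity:
`|∫ ((v - w)·ω)₊ dω - ∫ (v·ω)₊ dω| ≤ σ(S^{d-1}) |w|`. [folklore] -/
theorem abs_sphereIntegral_hardSphereKernel_sub_le (v w : E) :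
    |(∫ ω, hardSphereKernel (v, w) ω ∂sphereMeasure) - ∫ ω, hardSphereKernel (v, 0) ω ∂sphereMeasure| ≤
      (sphereMeasure : Measure (sphere (0 : E) 1)).real univ * ‖w‖ := by
  haveI := isFiniteMeasure_sphereMeasure (E := E)
  have hc : ∀ u : E, Continuous fun ω : sphere (0 : E) 1 => hardSphereKernel (v, u) ω := fun u => by
    unfold hardSphereKernel; fun_prop
  have hi : ∀ u : E, Integrable (fun ω : sphere (0 : E) 1 => hardSphereKernel (v, u) ω) sphereMeasure :=
    fun u => (hc u).integrable_of_hasCompactSupport (HasCompactSupport.of_compactSpace _)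
  rw [← integral_sub (hi w) (hi 0), ← Real.norm_eq_abs]
  have hpt : ∀ ω : sphere (0 : E) 1, ‖hardSphereKernel (v, w) ω - hardSphereKernel (v, 0) ω‖ ≤ ‖w‖ := by
    intro ω
    have h1 : |⟪w, (ω : E)⟫_ℝ| ≤ ‖w‖ := abs_inner_sphere_le w ω
    simp only [hardSphereKernel, sub_zero, inner_sub_left, Real.norm_eq_abs]
    rw [abs_le]
    rw [abs_le] at h1
    constructor <;>
      rcases le_total ⟪v, (ω : E)⟫_ℝ 0 with h | h <;>
      rcases le_total (⟪v, (ω : E)⟫_ℝ - ⟪w, (ω : E)⟫_ℝ) 0 with h' | h' <;>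
      simp only [max_eq_right h, max_eq_left h, max_eq_right h', max_eq_left h'] <;> linarith
  calc ‖∫ ω, hardSphereKernel (v, w) ω - hardSphereKernel (v, 0) ω ∂sphereMeasure‖
      ≤ ∫ _ : sphere (0 : E) 1, ‖w‖ ∂sphereMeasure :=
        norm_integral_le_of_norm_le (integrable_const _) (Eventually.of_forall hpt)
    _ = _ := by rw [integral_const, smul_eq_mul, Measure.real]

/-- **The loss piece of a bounded mean-zero function is bounded**: if `|ψ| ≤ A` and `∫ ψ dM = 0`
then `|∫ (∫ ((v - w)·ω)₊ dω) ψ(w) dM(w)| ≤ σ(S^{d-1}) A ∫ |w| dM(w)` for every `v` (subtract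
`(∫ (v·ω)₊ dω) ∫ ψ dM = 0` and use the Lipschitz bound in `w`). [folklore] -/
theorem abs_lossAction_le_of_integral_eq_zero {ψ : E → ℝ} (hψ : Measurable ψ) {A : ℝ}
    (hA : ∀ w, |ψ w| ≤ A) (h0 : ∫ w, ψ w ∂stdGaussian E = 0) (v : E) :
    |∫ w, ∫ ω, hardSphereKernel (v, w) ω * ψ w ∂sphereMeasure ∂stdGaussian E| ≤
      (sphereMeasure : Measure (sphere (0 : E) 1)).real univ * A * ∫ w, ‖w‖ ∂stdGaussian E := by
  haveI := isFiniteMeasure_sphereMeasure (E := E)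
  set S : ℝ := (sphereMeasure : Measure (sphere (0 : E) 1)).real univ with hS
  have hS0 : 0 ≤ S := measureReal_nonneg
  have hA0 : 0 ≤ A := (abs_nonneg _).trans (hA 0)
  set s : E → ℝ := fun w => ∫ ω, hardSphereKernel (v, w) ω ∂sphereMeasure with hs
  have hinner : ∀ w, ∫ ω, hardSphereKernel (v, w) ω * ψ w ∂sphereMeasure = s w * ψ w := fun w =>
    integral_mul_const _ _
  simp_rw [hinner]
  have hnorm : Integrable (fun w : E => ‖w‖) (stdGaussian E) := by
    simpa using (IsGaussian.memLp_id (stdGaussian E) 1 ENNReal.one_ne_top).integrable le_rfl |>.norm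
  have hsm : Measurable s :=
    (continuous_sphereIntegral_hardSphereKernel.comp (Continuous.prodMk_right v)).measurable
  have hψi : Integrable ψ (stdGaussian E) :=
    (integrable_const A).mono' hψ.aestronglyMeasurable
      (Eventually.of_forall fun w => by rw [Real.norm_eq_abs]; exact hA w)
  -- `(s w - s 0) ψ w` is integrable, bounded by `S |w| A`
  have hdiff : Integrable (fun w => (s w - s 0) * ψ w) (stdGaussian E) := by
    refine ((hnorm.const_mul (S * A))).mono' ((hsm.sub measurable_const).mul hψ).aestronglyMeasurable
      (Eventually.of_forall fun w => ?_)
    rw [Real.norm_eq_abs, abs_mul]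
    calc |s w - s 0| * |ψ w| ≤ (S * ‖w‖) * A :=
          mul_le_mul (abs_sphereIntegral_hardSphereKernel_sub_le v w) (hA w) (abs_nonneg _) (by positivity)
      _ = S * A * ‖w‖ := by ring
  have hsplit : (fun w => s w * ψ w) = fun w => (s w - s 0) * ψ w + s 0 * ψ w := by
    funext w; ring
  rw [hsplit, integral_add hdiff (hψi.const_mul _), integral_const_mul, h0, mul_zero, add_zero,
    ← Real.norm_eq_abs]
  calc ‖∫ w, (s w - s 0) * ψ w ∂stdGaussian E‖ ≤ ∫ w, S * A * ‖w‖ ∂stdGaussian E := by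
        refine norm_integral_le_of_norm_le (hnorm.const_mul _) (Eventually.of_forall fun w => ?_)
        rw [Real.norm_eq_abs, abs_mul]
        calc |s w - s 0| * |ψ w| ≤ (S * ‖w‖) * A :=
              mul_le_mul (abs_sphereIntegral_hardSphereKernel_sub_le v w) (hA w) (abs_nonneg _) (by positivity)
          _ = S * A * ‖w‖ := by ring
    _ = S * A * ∫ w, ‖w‖ ∂stdGaussian E := integral_const_mul _ _

/-! ### The linearised operator is additive on functions of Gaussian growth -/

/-- The kernel action `∫∫ B (ψ' + ψ_*' - ψ_*) dω dM_*` is additive under subtraction on measurable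
functions of Gaussian growth (all integrals converge absolutely). [folklore] -/
theorem kernelAction_sub_of_gaussGrowth {ψ₁ ψ₂ : E → ℝ} (h₁ : Measurable ψ₁) (h₂ : Measurable ψ₂)
    {C₁ C₂ : ℝ} (hC₁ : ∀ x, |ψ₁ x| ≤ C₁ * Real.exp (‖x‖ ^ 2 / 4))
    (hC₂ : ∀ x, |ψ₂ x| ≤ C₂ * Real.exp (‖x‖ ^ 2 / 4)) (v : E) :
    (∫ w, ∫ ω, hardSphereKernel (v, w) ω * ((ψ₁ - ψ₂) (collide ω (v, w)).1 +
        (ψ₁ - ψ₂) (collide ω (v, w)).2 - (ψ₁ - ψ₂) w) ∂sphereMeasure ∂stdGaussian E) =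
      (∫ w, ∫ ω, hardSphereKernel (v, w) ω * (ψ₁ (collide ω (v, w)).1 + ψ₁ (collide ω (v, w)).2 - ψ₁ w)
          ∂sphereMeasure ∂stdGaussian E) -
        ∫ w, ∫ ω, hardSphereKernel (v, w) ω * (ψ₂ (collide ω (v, w)).1 + ψ₂ (collide ω (v, w)).2 - ψ₂ w)
          ∂sphereMeasure ∂stdGaussian E := by
  have hC₁0 : 0 ≤ C₁ := by
    have h := hC₁ 0; rw [norm_zero] at h; norm_num at h; exact (abs_nonneg _).trans h
  have hC₂0 : 0 ≤ C₂ := by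
    have h := hC₂ 0; rw [norm_zero] at h; norm_num at h; exact (abs_nonneg _).trans h
  -- the two integrands
  set Φ : (E → ℝ) → E × sphere (0 : E) 1 → ℝ := fun ψ p => hardSphereKernel (v, p.1) p.2 *
    (ψ (collide p.2 (v, p.1)).1 + ψ (collide p.2 (v, p.1)).2 - ψ p.1) with hΦ
  have hB : Continuous fun p : E × sphere (0 : E) 1 => hardSphereKernel (v, p.1) p.2 := by
    unfold hardSphereKernel; fun_prop
  have hc1 : Continuous fun p : E × sphere (0 : E) 1 => (collide p.2 (v, p.1)).1 := by
    unfold collide; fun_prop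
  have hc2 : Continuous fun p : E × sphere (0 : E) 1 => (collide p.2 (v, p.1)).2 := by
    unfold collide; fun_prop
  have hΦm : ∀ {ψ : E → ℝ}, Measurable ψ → Measurable (Φ ψ) := fun hψ =>
    hB.measurable.mul (((hψ.comp hc1.measurable).add (hψ.comp hc2.measurable)).sub (hψ.comp measurable_fst))
  have hi₁ := fun w => integrable_sphere_section_of_bound (hΦm h₁)
    (fun w ω => abs_kernelIntegrand_le_of_gaussGrowth hC₁0 hC₁ v w ω) w
  have hi₂ := fun w => integrable_sphere_section_of_bound (hΦm h₂)
    (fun w ω => abs_kernelIntegrand_le_of_gaussGrowth hC₂0 hC₂ v w ω) w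
  have hI₁ := integrable_integral_sphere_of_gaussBound (hΦm h₁)
    (fun w ω => abs_kernelIntegrand_le_of_gaussGrowth hC₁0 hC₁ v w ω)
  have hI₂ := integrable_integral_sphere_of_gaussBound (hΦm h₂)
    (fun w ω => abs_kernelIntegrand_le_of_gaussGrowth hC₂0 hC₂ v w ω)
  have hinner : ∀ w, ∫ ω, hardSphereKernel (v, w) ω * ((ψ₁ - ψ₂) (collide ω (v, w)).1 +
      (ψ₁ - ψ₂) (collide ω (v, w)).2 - (ψ₁ - ψ₂) w) ∂sphereMeasure =
      (∫ ω, Φ ψ₁ (w, ω) ∂sphereMeasure) - ∫ ω, Φ ψ₂ (w, ω) ∂sphereMeasure := by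
    intro w
    rw [← integral_sub (hi₁ w) (hi₂ w)]
    refine integral_congr_ae (Eventually.of_forall fun ω => ?_)
    simp only [hΦ, Pi.sub_apply]
    ring
  rw [integral_congr_ae (Eventually.of_forall hinner), integral_sub hI₁ hI₂]

omit [FiniteDimensional ℝ E] [MeasurableSpace E] [BorelSpace E] in
/-- Linear functions have Gaussian growth: `|⟪m, v⟫| ≤ ‖m‖ e^{|v|²/4}` (`|v| ≤ 1 + |v|²/4 ≤ e^{|v|²/4}`).
[folklore] -/
theorem abs_inner_le_norm_mul_exp (m v : E) : |⟪m, v⟫_ℝ| ≤ ‖m‖ * Real.exp (‖v‖ ^ 2 / 4) := by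
  refine (abs_real_inner_le_norm m v).trans (mul_le_mul_of_nonneg_left ?_ (norm_nonneg _))
  have h := Real.add_one_le_exp (‖v‖ ^ 2 / 4)
  nlinarith [sq_nonneg (‖v‖ - 2)]

/-- **`L (ψ - ⟪m, ·⟫) = L ψ` at every velocity** for `ψ` measurable of Gaussian growth: the linear
function `⟪m, ·⟫` is a collision invariant (conservation of momentum), annihilated by `L`, and `L`
is additive on functions of Gaussian growth (Grad's splitting converges absolutely there).
[folklore] -/
theorem hardSphereLinearizedOp_sub_inner {ψ : E → ℝ} (hψ : Measurable ψ) {C : ℝ}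
    (hC : ∀ x, |ψ x| ≤ C * Real.exp (‖x‖ ^ 2 / 4)) (m v : E) :
    hardSphereLinearizedOp (fun x => ψ x - ⟪m, x⟫_ℝ) v = hardSphereLinearizedOp ψ v := by
  have hC0 : 0 ≤ C := by
    have h := hC 0; rw [norm_zero] at h; norm_num at h; exact (abs_nonneg _).trans h
  have hlin : Measurable fun x : E => ⟪m, x⟫_ℝ := (continuous_const.inner continuous_id).measurable
  have hlinC : ∀ x : E, |⟪m, x⟫_ℝ| ≤ ‖m‖ * Real.exp (‖x‖ ^ 2 / 4) := abs_inner_le_norm_mul_exp m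
  have hdiffC : ∀ x : E, |ψ x - ⟪m, x⟫_ℝ| ≤ (C + ‖m‖) * Real.exp (‖x‖ ^ 2 / 4) := fun x => by
    calc |ψ x - ⟪m, x⟫_ℝ| ≤ |ψ x| + |⟪m, x⟫_ℝ| := abs_sub _ _
      _ ≤ C * Real.exp (‖x‖ ^ 2 / 4) + ‖m‖ * Real.exp (‖x‖ ^ 2 / 4) := add_le_add (hC x) (hlinC x)
      _ = _ := by ring
  -- the linear function is annihilated by `L`, with absolutely convergent splitting
  have hinv : Literature.MathematicalPhysics.KineticTheory.IsCollisionInvariant fun x : E => ⟪m, x⟫_ℝ := by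
    intro ω p
    rw [← inner_add_right, ← inner_add_right, collide_fst_add_collide_snd]
  have hL0 : hardSphereLinearizedOp (fun x : E => ⟪m, x⟫_ℝ) v = 0 := by
    have := linearizedCollisionOp_eq_zero_of_isCollisionInvariant (E := E) hardSphereKernel hinv
    exact congrFun this v
  have e1 := hardSphereLinearizedOp_eq_kernel_sub_of_gaussGrowth (hψ.sub hlin) hdiffC v
  have e2 := hardSphereLinearizedOp_eq_kernel_sub_of_gaussGrowth hψ hC v
  have e3 := hardSphereLinearizedOp_eq_kernel_sub_of_gaussGrowth hlin hlinC v
  have hsub := kernelAction_sub_of_gaussGrowth hψ hlin hC hlinC v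
  change hardSphereLinearizedOp (ψ - fun x => ⟪m, x⟫_ℝ) v = _
  rw [e1, hsub, e2]
  rw [hL0] at e3
  simp only [Pi.sub_apply]
  linarith

end GeneralE

/-! ### A bounded, compactly supported, mean-zero function has a bounded image under `L` (`ℝ³`) -/

section E3

/-- The Carleman kernel of `ℝ³` is bounded by `p(0) |u|⁻¹`, `p` the standard normal density.
[folklore] -/
theorem carlemanKernel_one_le_inv_norm (v u : EuclideanSpace ℝ (Fin 3)) :
    carlemanKernel 1 v u ≤ gaussianPDFReal 0 1 0 * ‖u‖⁻¹ := by
  have h1 : ((1 : ℝ)⁻¹).toNNReal = 1 := by simp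
  simp only [carlemanKernel, Fintype.card_fin, show (3 : ℕ) - 2 = 1 from rfl, pow_one, h1]
  rw [mul_comm]
  refine mul_le_mul_of_nonneg_right ?_ (inv_nonneg.2 (norm_nonneg _))
  exact Literature.MathematicalPhysics.KineticTheory.gaussianPDFReal_zero_anti 1 (by simp)

/-- On the unit ball of `ℝ³`, `|u|⁻¹ ≤ √(2π) e^{1/8} G(u)` with `G = gradRadial 1` (and `G ≥ 0`
everywhere). [folklore] -/
theorem inv_norm_le_mul_gradRadial {u : EuclideanSpace ℝ (Fin 3)} (hu : ‖u‖ ≤ 1) :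
    ‖u‖⁻¹ ≤ Real.sqrt (2 * Real.pi * (1 : ℝ)⁻¹) * Real.exp (1 / 8) * gradRadial 1 u := by
  have hc : 0 < Real.sqrt (2 * Real.pi * (1 : ℝ)⁻¹) := by positivity
  simp only [gradRadial, Fintype.card_fin, show (3 : ℕ) - 2 = 1 from rfl, pow_one]
  rw [show Real.sqrt (2 * Real.pi * (1 : ℝ)⁻¹) * Real.exp (1 / 8) *
      ((Real.sqrt (2 * Real.pi * (1 : ℝ)⁻¹))⁻¹ * ‖u‖⁻¹ * Real.exp (-(1 / 8) * ‖u‖ ^ 2)) =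
      ‖u‖⁻¹ * Real.exp (1 / 8 + -(1 / 8) * ‖u‖ ^ 2) by rw [Real.exp_add]; field_simp]
  refine le_mul_of_one_le_right (inv_nonneg.2 (norm_nonneg _)) (Real.one_le_exp ?_)
  nlinarith [norm_nonneg u]

/-- **The Carleman gain of a bounded function of bounded support is bounded** (`ℝ³`): if `|ψ| ≤ A`
and `ψ = 0` off the closed ball of radius `R`, then for every `v`,
`|∫ k(v, u) ψ(v + u) du| ≤ A p(0) (√(2π) e^{1/8} ‖G‖₁ + |B_R|)` (`k ≤ p(0)|u|⁻¹`, and `|u|⁻¹` is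
bounded by `√(2π)e^{1/8} G` on the unit ball and by `1` off it). [folklore] -/
theorem abs_carlemanGain_le_of_bounded_support {ψ : EuclideanSpace ℝ (Fin 3) → ℝ} (hψ : Measurable ψ)
    {A R : ℝ} (hA : ∀ x, |ψ x| ≤ A) (hR : ∀ x, R < ‖x‖ → ψ x = 0)
    (v : EuclideanSpace ℝ (Fin 3)) :
    |carlemanGain 1 ψ v| ≤ A * gaussianPDFReal 0 1 0 *
      (Real.sqrt (2 * Real.pi * (1 : ℝ)⁻¹) * Real.exp (1 / 8) * (∫ u : EuclideanSpace ℝ (Fin 3), gradRadial 1 u) +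
        (volume (closedBall (0 : EuclideanSpace ℝ (Fin 3)) R)).toReal) := by
  have hA0 : 0 ≤ A := (abs_nonneg _).trans (hA 0)
  set p₀ : ℝ := gaussianPDFReal 0 1 0 with hp₀
  have hp₀0 : 0 ≤ p₀ := gaussianPDFReal_nonneg _ _ _
  set cG : ℝ := Real.sqrt (2 * Real.pi * (1 : ℝ)⁻¹) * Real.exp (1 / 8) with hcG
  have hcG0 : 0 ≤ cG := by positivity
  -- Gaussian growth of `ψ` (for the integrability lemmas of the tree)
  have hC : ∀ x, |ψ x| ≤ A * Real.exp (‖x‖ ^ 2 / 4) := fun x =>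
    (hA x).trans (le_mul_of_one_le_right hA0 (Real.one_le_exp (by positivity)))
  have hint := integrable_carlemanKernel_mul_of_gaussGrowth hψ hC v
  -- the majorant
  set h : EuclideanSpace ℝ (Fin 3) → ℝ := fun u => A * p₀ * (cG * gradRadial 1 u +
    (closedBall (-v) R).indicator 1 u) with hh
  have hGi := integrable_gradRadial (d := Fin 3) (β := 1) (by simp) one_pos
  have hIi : Integrable ((closedBall (-v) R).indicator (1 : EuclideanSpace ℝ (Fin 3) → ℝ)) := by
    have : IntegrableOn (fun _ : EuclideanSpace ℝ (Fin 3) => (1 : ℝ)) (closedBall (-v) R) volume :=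
      integrableOn_const (measure_closedBall_lt_top.ne)
    exact this.integrable_indicator measurableSet_closedBall
  have hhi : Integrable h := ((hGi.const_mul cG).add hIi).const_mul (A * p₀)
  have hle : ∀ u, ‖carlemanKernel 1 v u * ψ (v + u)‖ ≤ h u := by
    intro u
    rw [Real.norm_eq_abs, abs_mul, abs_of_nonneg (carlemanKernel_nonneg 1 v u)]
    by_cases hvu : R < ‖v + u‖
    · rw [hR _ hvu, abs_zero, mul_zero]
      exact mul_nonneg (mul_nonneg hA0 hp₀0) (add_nonneg (mul_nonneg hcG0 (gradRadial_nonneg 1 u))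
        (indicator_nonneg (fun _ _ => zero_le_one) _))
    · have hmem : u ∈ closedBall (-v) R := by
        rw [mem_closedBall, dist_eq_norm, sub_neg_eq_add, add_comm]; exact not_lt.1 hvu
      rw [hh]; dsimp only
      rw [indicator_of_mem hmem, Pi.one_apply]
      have hk := carlemanKernel_one_le_inv_norm v u
      have hinv : ‖u‖⁻¹ ≤ cG * gradRadial 1 u + 1 := by
        rcases le_or_gt ‖u‖ 1 with hu1 | hu1
        · exact (inv_norm_le_mul_gradRadial hu1).trans (le_add_of_nonneg_right zero_le_one)
        · have : ‖u‖⁻¹ ≤ 1 := inv_le_one_of_one_le₀ hu1.le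
          linarith [mul_nonneg hcG0 (gradRadial_nonneg 1 u)]
      calc carlemanKernel 1 v u * |ψ (v + u)| ≤ (p₀ * ‖u‖⁻¹) * A :=
            mul_le_mul hk (hA _) (abs_nonneg _) (mul_nonneg hp₀0 (inv_nonneg.2 (norm_nonneg _)))
        _ = A * p₀ * ‖u‖⁻¹ := by ring
        _ ≤ A * p₀ * (cG * gradRadial 1 u + 1) := mul_le_mul_of_nonneg_left hinv (mul_nonneg hA0 hp₀0)
  rw [carlemanGain, ← Real.norm_eq_abs]
  refine (norm_integral_le_of_norm_le hhi (Eventually.of_forall hle)).trans (le_of_eq ?_)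
  rw [hh, integral_const_mul, integral_add (hGi.const_mul cG) hIi, integral_const_mul,
    integral_indicator_one measurableSet_closedBall, Measure.real,
    Measure.addHaar_closedBall_center volume (-v) R]

/-- **A bounded, mean-zero function of bounded support has a bounded image under the linearised
hard-sphere operator of `ℝ³`**: if `ψ` is measurable, `|ψ| ≤ A`, `ψ = 0` off `|x| ≤ R` and
`∫ ψ dM = 0`, then `sup_v |L ψ (v)| < ∞`. Grad's splitting `L ψ = 2 ∫ k ψ - K₁ ψ - ν ψ` (the two gain
pieces coincide in `ℝ³`): the Carleman gain is bounded (`abs_carlemanGain_le_of_bounded_support`), the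
loss piece is bounded because `ψ` has mean zero (`abs_lossAction_le_of_integral_eq_zero`), and
`ν ψ` is bounded because `ψ` has bounded support and `ν(v) ≤ C_ν (1 + |v|)`. [folklore] -/
theorem exists_abs_hardSphereLinearizedOp_le_of_bounded_support {ψ : EuclideanSpace ℝ (Fin 3) → ℝ}
    (hψ : Measurable ψ) {A R : ℝ} (hA : ∀ x, |ψ x| ≤ A) (hR0 : 0 ≤ R) (hR : ∀ x, R < ‖x‖ → ψ x = 0)
    (h0 : ∫ w, ψ w ∂stdGaussian (EuclideanSpace ℝ (Fin 3)) = 0) :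
    ∃ B : ℝ, ∀ v, |hardSphereLinearizedOp ψ v| ≤ B := by
  have hA0 : 0 ≤ A := (abs_nonneg _).trans (hA 0)
  have hC : ∀ x, |ψ x| ≤ A * Real.exp (‖x‖ ^ 2 / 4) := fun x =>
    (hA x).trans (le_mul_of_one_le_right hA0 (Real.one_le_exp (by positivity)))
  set BG : ℝ := A * gaussianPDFReal 0 1 0 *
      (Real.sqrt (2 * Real.pi * (1 : ℝ)⁻¹) * Real.exp (1 / 8) * (∫ u : EuclideanSpace ℝ (Fin 3), gradRadial 1 u) +
        (volume (closedBall (0 : EuclideanSpace ℝ (Fin 3)) R)).toReal) with hBG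
  set BL : ℝ := (sphereMeasure : Measure (sphere (0 : EuclideanSpace ℝ (Fin 3)) 1)).real univ * A *
    ∫ w, ‖w‖ ∂stdGaussian (EuclideanSpace ℝ (Fin 3)) with hBL
  set Bν : ℝ := frequencyConst (EuclideanSpace ℝ (Fin 3)) * (1 + R) * A with hBν
  refine ⟨2 * BG + BL + Bν, fun v => ?_⟩
  rw [hardSphereLinearizedOp_eq_kernel_sub_of_gaussGrowth hψ hC v, kernelAction_eq_pieces_of_gaussGrowth hψ hC v,
    integral_integral_gain_snd_eq_fst hψ hC v, integral_integral_gain_fst_eq_carlemanGain hψ hC v]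
  have h1 := abs_carlemanGain_le_of_bounded_support hψ hA hR v
  have h2 := abs_lossAction_le_of_integral_eq_zero hψ hA h0 v
  have h3 : |collisionFrequency v * ψ v| ≤ Bν := by
    rcases le_or_gt ‖v‖ R with hv | hv
    · refine (abs_collisionFrequency_mul_le v (ψ v)).trans ?_
      rw [hBν]
      exact mul_le_mul (mul_le_mul_of_nonneg_left (by linarith) frequencyConst_nonneg) (hA v)
        (abs_nonneg _) (mul_nonneg frequencyConst_nonneg (by linarith))
    · rw [hR v hv, mul_zero, abs_zero, hBν]
      exact mul_nonneg (mul_nonneg frequencyConst_nonneg (by linarith)) hA0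
  rw [← hBG] at h1
  rw [← hBL] at h2
  have key : ∀ a c d : ℝ, |a + a - c - d| ≤ |a| + |a| + |c| + |d| := fun a c d => by
    calc |a + a - c - d| ≤ |a + a - c| + |d| := abs_sub _ _
      _ ≤ |a + a| + |c| + |d| := by linarith [abs_sub (a + a) c]
      _ ≤ |a| + |a| + |c| + |d| := by linarith [abs_add_le a a]
  linarith [key (carlemanGain 1 ψ v) (∫ w, ∫ ω, hardSphereKernel (v, w) ω * ψ w ∂sphereMeasure
    ∂stdGaussian (EuclideanSpace ℝ (Fin 3))) (collisionFrequency v * ψ v)]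

end E3

end

end Literature.Analysis.UnboundedOperators
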